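import Summits.Langlands.Langlands.Statement
import HarnessLib

/-!
# Langlands — summit statement (D-0017)

Single-conjunct summit: the statement `Langlands : Prop` (global Langlands reciprocity for `GL_n`
over number fields, BOTH directions, local–global compatibility at ALL finite places, geometric =
unramified almost everywhere + de Rham above `ℓ`; human ruling D-0018(1); Buzzard–Gee 2014
Conj. 3.2.1/3.2.2 (L-algebraic `π`, canonical printed text), Taylor ICM 2002 Conj. 7/8,
Fontaine–Mazur 1995 Conj. 1; Clozel 1990 Conj. 4.5 is the equivalent C-algebraic form;
functoriality for general `G` out of scope) is defined in
`Summits/Langlands/Langlands/Statement.lean`; this file re-exports it by import. No declaration here.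
-/
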